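import Literature.Analysis.FluidPDE.BilliardTensorDivFree
import Literature.Analysis.FluidPDE.CollisionPayload
import HarnessLib

/-!
# The spatial trace of Serre's billiard tensor: the bookkeeping identity (17)

For the mass–momentum tensor with collitons `M = Σ_p (1, v_p) ⊗ (1, v_p) dt|_{γ(p)} +
Σ_coll (1/|[v]|) (0, [v]) ⊗ (0, [v]) dℓ` of a hard-sphere motion (Serre 2024 §5 p. 1438;
`Literature.Analysis.FluidPDE.BilliardTensorDivFree`), the spatial trace is
`Tr_d M = Σ_p |v_p|² dt|_{γ(p)} + Σ_coll |[v]| dℓ`, whose total mass over a time window of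
length `T` is Serre's (17): `‖Tr_d M‖ = 2 E T + 2a Σ_coll |[v]|` (`2a = ε` the diameter). Together
with `‖Div S‖` ((16), `abs_stMomentumObservable_le`) this is the right-hand side of Compensated
Integrability (14) in the application. This file gives the trace in the tested form used
throughout the block: the pairing of `Tr_d M` with a scalar space–time test function `χ`.

* `IsHardSphereTrajectory.intervalIntegrable_of_continuous_flights` — utility: an observable
  `Φ t z` continuous along every free flight is interval integrable along the trajectory (the
  integrability half of the weak balance law, by induction on the collision times);
* `traceStreaming χ t z = Σ_i χ(t, x_i) |v_i|²`, `collitonTraceKernel ε φ i j pre post =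
  ½ (ε/|Δv_i|) ∫₀¹ φ(x_j + proj(s n_{ij})) |Δv_i|² ds`, `stTracePairing ε χ γ a b` (streaming
  integral over `[a, b]` plus colliton traces over the collision times in `(a, b]`);
* `IsHardSphereTrajectory.sum_collidingPairs_collitonTraceKernel_one` — at a collision the two
  colliton traces of the constant field `1` add up to `ε |Δv_i| = (ε/2) · velocityJump γ t`;
* **`IsHardSphereTrajectory.stTracePairing_one`** — Serre's (17) in the tree's units:
  `⟨Tr_d M, 1⟩ = 2 E (b - a) + (ε/2) Σᶠ_{t ∈ C ∩ (a,b]} velocityJump γ t` (energy conservation for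
  the streaming part);
* `IsHardSphereTrajectory.abs_stTracePairing_le` — `|⟨Tr_d M, χ⟩| ≤ C (2E(b-a) + (ε/2) Σ jumps)`
  for `|χ| ≤ C` jointly continuous.

## References

* D. Serre, *Compensated integrability on tori; a priori estimate for space-periodic gas flows*,
  C. R. Math. Acad. Sci. Paris 362 (2024) 1425–1444, §5 (17), p. 1439. [Serre2024]
-/

open Set Filter Function MeasureTheory
open scoped InnerProductSpace Topology

namespace Literature.Analysis.FluidPDE

noncomputable section

open Literature.Analysis.FunctionSpaces

/-! ## Integrability along a trajectory of observables continuous along flights -/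

section Integrable

variable {d : Type*} [Fintype d] {X : Type*} {N : ℕ} [TopologicalSpace X]
  {E : Type*} [NormedAddCommGroup E] {G : Geometry d X} {ε : ℝ} {γ : ℝ → Config N d X}

/-- **Integrability along a hard-sphere trajectory.** If the time-dependent observable `Φ t z`
is continuous in `t` along every free flight with absolute time
(`t ↦ Φ t (S_{t - t₀} z)` continuous), then `s ↦ Φ s (γ s)` is interval integrable on every window
`[a, b]`: between consecutive collision times the trajectory *is* a free flight
(induction on the number of collision times in `(a, b]`). [folklore] -/
theorem IsHardSphereTrajectory.intervalIntegrable_of_continuous_flights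
    (h : IsHardSphereTrajectory G ε N γ) {Φ : ℝ → Config N d X → E}
    (hΦ : ∀ (z : Config N d X) (t₀ : ℝ), Continuous fun t => Φ t (freeFlight G (t - t₀) z))
    {a b : ℝ} (hab : a ≤ b) : IntervalIntegrable (fun s => Φ s (γ s)) volume a b := by
  classical
  -- integrability on a stretch `[a, T]` with `(a, T)` collision-free
  have key : ∀ {a T : ℝ}, a ≤ T → (∀ σ ∈ Ioo a T, σ ∉ collisionTimes G ε γ) →
      IntervalIntegrable (fun s => Φ s (γ s)) volume a T := by
    intro a T haT hfree
    have hint : IntervalIntegrable (fun s => Φ s (freeFlight G (s - a) (γ a))) volume a T :=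
      (hΦ (γ a) a).intervalIntegrable a T
    refine hint.congr_uIoo ?_
    rw [uIoo_of_le haT]
    intro s hs
    show Φ s (freeFlight G (s - a) (γ a)) = Φ s (γ s)
    rw [h.eq_freeFlight_of_Ioo_free hfree ⟨hs.1.le, hs.2⟩]
  suffices H : ∀ (n : ℕ) (a : ℝ), a ≤ b →
      (h.finite_collisionTimes_inter_Ioc a b).toFinset.card = n →
      IntervalIntegrable (fun s => Φ s (γ s)) volume a b from H _ a hab rfl
  intro n
  induction n with
  | zero =>
    intro a hab hcard
    rw [Finset.card_eq_zero] at hcard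
    refine key hab fun σ hσ hcol => ?_
    exact Finset.notMem_empty σ (hcard ▸ (Set.Finite.mem_toFinset _).2 ⟨hcol, hσ.1, hσ.2.le⟩)
  | succ n ih =>
    intro a hab hcard
    set S := (h.finite_collisionTimes_inter_Ioc a b).toFinset with hS
    have hne : S.Nonempty := Finset.card_pos.1 (by omega)
    have hTmem : S.min' hne ∈ collisionTimes G ε γ ∩ Ioc a b :=
      (Set.Finite.mem_toFinset _).1 (S.min'_mem hne)
    set T := S.min' hne with hT
    have haT : a < T := hTmem.2.1
    have hTb : T ≤ b := hTmem.2.2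
    have hmemS : ∀ {σ}, σ ∈ collisionTimes G ε γ → a < σ → σ ≤ b → σ ∈ S := fun hσ haσ hσb =>
      (Set.Finite.mem_toFinset _).2 ⟨hσ, haσ, hσb⟩
    have hfree : ∀ σ ∈ Ioo a T, σ ∉ collisionTimes G ε γ := fun σ hσ hcol =>
      (not_lt.2 (S.min'_le σ (hmemS hcol hσ.1 (hσ.2.le.trans hTb)))) hσ.2
    have hcard' : (h.finite_collisionTimes_inter_Ioc T b).toFinset.card = n := by
      have hE : (h.finite_collisionTimes_inter_Ioc T b).toFinset = S.erase T := by
        ext σ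
        simp only [Set.Finite.mem_toFinset, Finset.mem_erase, mem_inter_iff, mem_Ioc]
        constructor
        · rintro ⟨hσ, hTσ, hσb⟩
          exact ⟨hTσ.ne', hmemS hσ (haT.trans hTσ) hσb⟩
        · rintro ⟨hne', hσS⟩
          obtain ⟨hσ, haσ, hσb⟩ := (Set.Finite.mem_toFinset _).1 hσS
          exact ⟨hσ, lt_of_le_of_ne (S.min'_le σ hσS) (Ne.symm hne'), hσb⟩
      rw [hE, Finset.card_erase_of_mem (S.min'_mem hne), hcard]
      rfl
    exact (key haT.le hfree).trans (ih T hTb hcard')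

end Integrable

/-! ## The trace pairing -/

section Trace

variable {d : Type*} [Fintype d] {N : ℕ}

/-- The **streaming part of the spatial trace** tested against `χ`: `Σ_i χ(t, x_i) |v_i|²`
(`Tr_d` of `Σ_i (1, v_i) ⊗ (1, v_i)` at the particles; twice the kinetic energy observable of
`CollisionalTransfer.energyObservable (χ t)`). [cite: Serre2024, §5 (17)] -/
def traceStreaming (χ : ℝ → UnitAddTorus d → ℝ) (t : ℝ) (z : Config N d (UnitAddTorus d)) : ℝ :=
  ∑ i, χ t (z i).1 * ‖(z i).2‖ ^ 2

/-- The **trace of a colliton** of the ordered pair `(i, j)` tested against `φ`: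
`½ (ε/|Δv_i|) ∫₀¹ φ(x_j + proj(s n_{ij})) |Δv_i|² ds` — the trace `|Δv_i|` per unit length of the
tensor `Δv_i ⊗ Δv_i / |Δv_i|`, integrated with arc length `ε ds` along the contact segment, halved
for the two orientations. [cite: Serre2024, §5 (17)] -/
def collitonTraceKernel (ε : ℝ) (φ : UnitAddTorus d → ℝ) (i j : Fin N)
    (pre post : Config N d (UnitAddTorus d)) : ℝ :=
  2⁻¹ * (ε / ‖(post i).2 - (pre i).2‖) *
    ∫ s in (0 : ℝ)..1,
      φ ((post j).1 + Torus.proj (s • (Torus.geometry d).sepVec (post i).1 (post j).1)) *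
        ‖(post i).2 - (pre i).2‖ ^ 2

/-- The **trace pairing** `⟨Tr_d M, χ⟩` of Serre's tensor over the window: streaming part
integrated over `[a, b]` plus the colliton traces over the collision times in `(a, b]`.
[cite: Serre2024, §5 (17)] -/
def stTracePairing (ε : ℝ) (χ : ℝ → UnitAddTorus d → ℝ) (γ : ℝ → Config N d (UnitAddTorus d))
    (a b : ℝ) : ℝ :=
  (∫ s in a..b, traceStreaming χ s (γ s)) +
    ∑ᶠ t ∈ collisionTimes (Torus.geometry d) ε γ ∩ Ioc a b,
      ∑ p ∈ collidingPairs (Torus.geometry d) ε (γ t),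
        collitonTraceKernel ε (χ t) p.1 p.2 (leftLim γ t) (γ t)

/-- The streaming trace of the constant field `1` is twice the kinetic energy. [folklore] -/
theorem traceStreaming_one (t : ℝ) (z : Config N d (UnitAddTorus d)) :
    traceStreaming (fun _ _ => (1 : ℝ)) t z = 2 * configEnergy z := by
  simp only [traceStreaming, one_mul, configEnergy]
  ring

/-- The trace of a colliton of the constant field `1` is `½ ε |Δv_i|` (also when `Δv_i = 0`).
[folklore] -/
theorem collitonTraceKernel_one (ε : ℝ) (i j : Fin N) (pre post : Config N d (UnitAddTorus d)) :
    collitonTraceKernel ε (fun _ => (1 : ℝ)) i j pre post = 2⁻¹ * ε * ‖(post i).2 - (pre i).2‖ := by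
  rw [collitonTraceKernel, intervalIntegral.integral_const, sub_zero, one_smul]
  by_cases h0 : ‖(post i).2 - (pre i).2‖ = 0
  · simp [h0]
  · field_simp

/-- A colliton trace is bounded by `C · ½ ε |Δv_i|` when `|φ| ≤ C` (and `ε ≥ 0`). [folklore] -/
theorem abs_collitonTraceKernel_le {ε C : ℝ} (hε : 0 ≤ ε) {φ : UnitAddTorus d → ℝ}
    (hφ : ∀ x, |φ x| ≤ C) (i j : Fin N) (pre post : Config N d (UnitAddTorus d)) :
    |collitonTraceKernel ε φ i j pre post| ≤ C * (2⁻¹ * ε * ‖(post i).2 - (pre i).2‖) := by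
  have hC : 0 ≤ C := (abs_nonneg _).trans (hφ 0)
  set D : ℝ := ‖(post i).2 - (pre i).2‖ with hD
  have hD0 : 0 ≤ D := norm_nonneg _
  have hint : ‖∫ s in (0 : ℝ)..1,
      φ ((post j).1 + Torus.proj (s • (Torus.geometry d).sepVec (post i).1 (post j).1)) * D ^ 2‖ ≤
      C * D ^ 2 * |1 - 0| := by
    refine intervalIntegral.norm_integral_le_of_norm_le_const fun s _ => ?_
    rw [Real.norm_eq_abs, abs_mul, abs_of_nonneg (sq_nonneg D)]
    exact mul_le_mul_of_nonneg_right (hφ _) (sq_nonneg D)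
  rw [sub_zero, abs_one, mul_one, Real.norm_eq_abs] at hint
  rw [collitonTraceKernel, ← hD, abs_mul, abs_mul, abs_of_nonneg (by norm_num : (0 : ℝ) ≤ 2⁻¹)]
  by_cases h0 : D = 0
  · simp [h0]
  · have hDpos : 0 < D := lt_of_le_of_ne hD0 (Ne.symm h0)
    rw [abs_of_nonneg (div_nonneg hε hD0)]
    calc 2⁻¹ * (ε / D) * |∫ s in (0 : ℝ)..1,
          φ ((post j).1 + Torus.proj (s • (Torus.geometry d).sepVec (post i).1 (post j).1)) * D ^ 2|
        ≤ 2⁻¹ * (ε / D) * (C * D ^ 2) := by gcongr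
      _ = C * (2⁻¹ * ε * D) := by
          field_simp

namespace IsHardSphereTrajectory

variable {ε : ℝ} {γ : ℝ → Config N d (UnitAddTorus d)}

/-- At a collision of `(i, j)` both orientations contribute `½ ε |Δv_i|` (`|Δv_j| = |Δv_i|`), so
the colliton traces of the constant field add up to `ε |Δv_i| = (ε/2) velocityJump γ t`.
[cite: Serre2024, §5 (17)] -/
theorem sum_collidingPairs_collitonTraceKernel_one (h : IsHardSphereTrajectory (Torus.geometry d) ε N γ)
    {t : ℝ} {i j : Fin N} (hij : i ≠ j) (hc : γ t ∈ contactSet (Torus.geometry d) N ε i j) :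
    ∑ p ∈ collidingPairs (Torus.geometry d) ε (γ t),
        collitonTraceKernel ε (fun _ => (1 : ℝ)) p.1 p.2 (leftLim γ t) (γ t) =
      2⁻¹ * ε * velocityJump γ t := by
  rw [h.sum_collidingPairs_eq hij hc, collitonTraceKernel_one, collitonTraceKernel_one,
    h.vel_sub_leftLim_right_eq_neg hij hc, norm_neg, h.velocityJump_eq hij hc]
  ring

/-- Each translation of the torus geometry is continuous. [folklore] -/
private theorem torus_continuous_translate₃ (x : UnitAddTorus d) :
    Continuous ((Torus.geometry d).translate x) :=
  continuous_const.add Torus.continuous_proj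

/-- **Serre's trace bookkeeping (17)**, tested against the constant `1`: along a hard-sphere
trajectory on `T^d`, for `a ≤ b`,
`⟨Tr_d M, 1⟩ = 2 E (b - a) + (ε/2) Σᶠ_{t ∈ C ∩ (a,b]} velocityJump γ t`
(`Σ_p |v_p|² = 2E` is conserved along the motion; each collision's colliton has trace mass
`ε |[v]| = (ε/2) velocityJump`; Serre: `‖Tr_d M‖ = 2ET + 2aΣ|[v]|`). [cite: Serre2024, §5 (17)] -/
theorem stTracePairing_one (h : IsHardSphereTrajectory (Torus.geometry d) ε N γ) (a b : ℝ) :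
    stTracePairing ε (fun _ _ => (1 : ℝ)) γ a b =
      2 * configEnergy (γ a) * (b - a) +
        2⁻¹ * ε * ∑ᶠ t ∈ collisionTimes (Torus.geometry d) ε γ ∩ Ioc a b, velocityJump γ t := by
  rw [stTracePairing]
  have hstream : (∫ s in a..b, traceStreaming (fun _ _ => (1 : ℝ)) s (γ s)) =
      2 * configEnergy (γ a) * (b - a) := by
    have hcongr : EqOn (fun s => traceStreaming (fun _ _ => (1 : ℝ)) s (γ s))
        (fun _ => 2 * configEnergy (γ a)) (uIcc a b) := fun s _ => by
      show traceStreaming (fun _ _ => (1 : ℝ)) s (γ s) = 2 * configEnergy (γ a)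
      rw [traceStreaming_one, IsHardSphereTrajectory.configEnergy_eq_holds h s a]
    rw [intervalIntegral.integral_congr hcongr, intervalIntegral.integral_const, smul_eq_mul]
    ring
  have hcoll : (∑ᶠ t ∈ collisionTimes (Torus.geometry d) ε γ ∩ Ioc a b,
      ∑ p ∈ collidingPairs (Torus.geometry d) ε (γ t),
        collitonTraceKernel ε (fun _ => (1 : ℝ)) p.1 p.2 (leftLim γ t) (γ t)) =
      2⁻¹ * ε * ∑ᶠ t ∈ collisionTimes (Torus.geometry d) ε γ ∩ Ioc a b, velocityJump γ t := by
    rw [mul_finsum_mem]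
    refine finsum_mem_congr rfl fun t ht => ?_
    obtain ⟨i, j, hij, hc⟩ := ht.1
    exact h.sum_collidingPairs_collitonTraceKernel_one hij hc
  rw [hstream, hcoll]

/-- **The trace pairing is controlled by the trace mass**: for a jointly continuous test function
with `|χ| ≤ C` and `ε ≥ 0`,
`|⟨Tr_d M, χ⟩| ≤ C (2E(b - a) + (ε/2) Σᶠ_{t ∈ C ∩ (a,b]} velocityJump γ t)` — i.e.
`‖Tr_d M‖_M ≤ 2E T + ε Σ_coll |[v]|`, Serre's (17) as an inequality of total variation.
[cite: Serre2024, §5 (17)] -/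
theorem abs_stTracePairing_le (h : IsHardSphereTrajectory (Torus.geometry d) ε N γ) (hε : 0 ≤ ε)
    {χ : ℝ → UnitAddTorus d → ℝ} (hχc : Continuous (Torus.stLift χ)) {C : ℝ}
    (hχ : ∀ t x, |χ t x| ≤ C) {a b : ℝ} (hab : a ≤ b) :
    |stTracePairing ε χ γ a b| ≤
      C * (2 * configEnergy (γ a) * (b - a) +
        2⁻¹ * ε * ∑ᶠ t ∈ collisionTimes (Torus.geometry d) ε γ ∩ Ioc a b, velocityJump γ t) := by
  have hC : 0 ≤ C := (abs_nonneg _).trans (hχ 0 0)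
  -- streaming part
  have hflight : ∀ (z : Config N d (UnitAddTorus d)) (t₀ : ℝ),
      Continuous fun t => traceStreaming χ t (freeFlight (Torus.geometry d) (t - t₀) z) := by
    intro z t₀
    simp only [traceStreaming, freeFlight_apply, Torus.geometry_translate]
    refine continuous_finsetSum _ fun i _ => Continuous.mul ?_ continuous_const
    have hpath : Continuous fun t : ℝ =>
        ((t, Torus.repr (z i).1 + (t - t₀) • (z i).2) : ℝ × EuclideanSpace ℝ d) := by fun_prop
    have heq : (fun t : ℝ => χ t ((z i).1 + Torus.proj ((t - t₀) • (z i).2))) =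
        fun t => Torus.stLift χ (t, Torus.repr (z i).1 + (t - t₀) • (z i).2) := by
      funext t
      rw [Torus.stLift_apply, Torus.proj_add, Torus.proj_repr]
    rw [heq]
    exact hχc.comp hpath
  have hint := h.intervalIntegrable_of_continuous_flights hflight hab
  have hbound : ∀ s, |traceStreaming χ s (γ s)| ≤ C * (2 * configEnergy (γ a)) := by
    intro s
    rw [IsHardSphereTrajectory.configEnergy_eq_holds h a s, ← traceStreaming_one s (γ s)]
    simp only [traceStreaming, one_mul, Finset.mul_sum]
    refine (Finset.abs_sum_le_sum_abs _ _).trans (Finset.sum_le_sum fun i _ => ?_)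
    rw [abs_mul, abs_of_nonneg (sq_nonneg ‖((γ s) i).2‖)]
    exact mul_le_mul_of_nonneg_right (hχ _ _) (sq_nonneg _)
  have hstream : |∫ s in a..b, traceStreaming χ s (γ s)| ≤ C * (2 * configEnergy (γ a) * (b - a)) := by
    have h1 := intervalIntegral.norm_integral_le_of_norm_le_const (a := a) (b := b)
      (f := fun s => traceStreaming χ s (γ s)) (C := C * (2 * configEnergy (γ a)))
      fun s _ => by simpa only [Real.norm_eq_abs] using hbound s
    rw [abs_of_nonneg (sub_nonneg.2 hab), Real.norm_eq_abs] at h1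
    linarith [h1]
  -- colliton part
  have hfin := h.finite_collisionTimes_inter_Ioc a b
  have hcoll : |∑ᶠ t ∈ collisionTimes (Torus.geometry d) ε γ ∩ Ioc a b,
      ∑ p ∈ collidingPairs (Torus.geometry d) ε (γ t),
        collitonTraceKernel ε (χ t) p.1 p.2 (leftLim γ t) (γ t)| ≤
      C * (2⁻¹ * ε * ∑ᶠ t ∈ collisionTimes (Torus.geometry d) ε γ ∩ Ioc a b, velocityJump γ t) := by
    rw [finsum_mem_eq_finite_toFinset_sum _ hfin, finsum_mem_eq_finite_toFinset_sum _ hfin,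
      Finset.mul_sum, Finset.mul_sum]
    refine (Finset.abs_sum_le_sum_abs _ _).trans (Finset.sum_le_sum fun t ht => ?_)
    obtain ⟨⟨i, j, hij, hc⟩, -⟩ := (Set.Finite.mem_toFinset _).1 ht
    rw [h.sum_collidingPairs_eq hij hc]
    refine (abs_add_le _ _).trans ((add_le_add (abs_collitonTraceKernel_le hε (hχ t) _ _ _ _)
      (abs_collitonTraceKernel_le hε (hχ t) _ _ _ _)).trans_eq ?_)
    rw [h.vel_sub_leftLim_right_eq_neg hij hc, norm_neg, h.velocityJump_eq hij hc]
    ring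
  rw [stTracePairing, mul_add]
  exact (abs_add_le _ _).trans (add_le_add hstream hcoll)

end IsHardSphereTrajectory

end Trace

end

end Literature.Analysis.FluidPDE
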